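import Literature.MathematicalPhysics.QuantumFieldTheory.SUNBakryEmeryPoincare

/-!
# Strong-coupling front, J-SC12 (part 2/3): the tree's Poincaré machinery on `SU(N)` with an
ABSTRACT curvature constant — observatory of the non-perturbative crossover; no mass-gap claim

IR-3 v2 TWO-FRONT CROSSOVER LEDGER, front SC (`β₀`).  observatory of the non-perturbative crossover; no mass-gap claim.

ABSOLUTE RULE. No internally-minted statement may enter as a cited fact. Every hypothesis is either
kernel-proved in this package or a verbatim quotation of a PUBLISHED theorem with page reference. The
manuscript(s) under audit are NOT citable for their own disputed steps — they are the thing under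
adjudication; programme-internal (2001/route/tribunal) claims are never citable.  THIS FILE HAS NO
HYPOTHESES: every statement below is kernel-proved from the tree; names of published results appear as
ATTRIBUTION only (Bochner–Lichnerowicz–Bakry–Émery curvature–dimension argument).

WHAT THIS FILE PROVES: verbatim clones of the tree's `SUNBakryEmery.poincare_of_approx`,
`poincare_of_thm4`, `poincare_pot` (duality argument + density of `{e^{-S/2} p}`, THM(IV)) in which
the Bakry–Émery constant `N/2 - |c|‖B‖_op` is replaced by ANY `K > 0` satisfying the integrated Bochner
inequality `K ∫ e^S Γ(v,v) dσ ≤ ∫ e^S (L_S v)² dσ` for all smooth `v` (`S = c Re tr(· B)`):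
`poincare_pot_K : K ∫ e^S (u - m)² dσ ≤ ∫ e^S Γ(u,u) dσ`.  Part 1 supplies such a `K` from the
curvature–dimension condition on `SU(2)`; part 3 assembles the window.  Independent of part 1.
-/

noncomputable section

open scoped Matrix ComplexConjugate BigOperators Matrix.Norms.Frobenius ContDiff Topology InnerProductSpace
open Matrix Complex Finset MeasureTheory Filter
open Literature.MathematicalPhysics.QuantumFieldTheory
open Literature.MathematicalPhysics.QuantumFieldTheory.SUNBakryEmery

namespace Summit.QuantumFields.BalabanUV.InfraRed.StrongCouplingDimensionalPoincare

variable {N : ℕ}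

/-- **Poincaré inequality from approximate solvability of the Poisson equation, with an ABSTRACT
curvature constant** (the tree's `SUNBakryEmery.poincare_of_approx` with its Bakry–Émery constant
`N/2 - |c|‖B‖_op` replaced by any `K > 0` for which the integrated Bochner inequality
`K ∫ e^S Γ(v,v) ≤ ∫ e^S (L_S v)²` holds for all smooth `v`): `K ∫ e^S (u - m)² ≤ ∫ e^S Γ(u,u)` whenever
`L_S v_k → u - m` in `L²(e^S σ)`. Proof verbatim from the tree (duality + Cauchy–Schwarz). [folklore] -/
theorem poincare_of_approx_K (hN : N ≠ 0) (c : ℝ) (B : Matrix (Fin N) (Fin N) ℂ) {K : ℝ} (hK : 0 < K)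
    (hGam : ∀ {v : Matrix (Fin N) (Fin N) ℂ → ℝ}, ContDiff ℝ ∞ v →
      K * ∫ g : SUN N, Real.exp (c * ((g : Matrix (Fin N) (Fin N) ℂ) * B).trace.re) * Gam v v g ∂(haarProbability (SUN N)) ≤
        ∫ g : SUN N, Real.exp (c * ((g : Matrix (Fin N) (Fin N) ℂ) * B).trace.re) *
          genL (fun Q => c * (Q * B).trace.re) v g ^ 2 ∂(haarProbability (SUN N)))
    {u : Matrix (Fin N) (Fin N) ℂ → ℝ} (hu : ContDiff ℝ ∞ u) (m : ℝ)
    (v : ℕ → Matrix (Fin N) (Fin N) ℂ → ℝ) (hv : ∀ k, ContDiff ℝ ∞ (v k))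
    (hconv : Tendsto (fun k => ∫ g : SUN N, Real.exp (c * ((g : Matrix (Fin N) (Fin N) ℂ) * B).trace.re) *
      (genL (fun Q => c * (Q * B).trace.re) (v k) g - (u g - m)) ^ 2 ∂(haarProbability (SUN N))) atTop (𝓝 0)) :
    K * ∫ g : SUN N, Real.exp (c * ((g : Matrix (Fin N) (Fin N) ℂ) * B).trace.re) * (u g - m) ^ 2
          ∂(haarProbability (SUN N)) ≤
      ∫ g : SUN N, Real.exp (c * ((g : Matrix (Fin N) (Fin N) ℂ) * B).trace.re) * Gam u u g
        ∂(haarProbability (SUN N)) := by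
  set σ := haarProbability (SUN N) with hσ
  set S : Matrix (Fin N) (Fin N) ℂ → ℝ := fun Q => c * (Q * B).trace.re with hSdef
  have hS : ContDiff ℝ ∞ S := contDiff_potential c B
  have hSc : Continuous fun g : SUN N => S g := continuous_restrict hS
  have hu0 : ContDiff ℝ ∞ (fun Q => u Q - m) := hu.sub contDiff_const
  -- the quantities
  set A : ℝ := ∫ g : SUN N, Real.exp (S g) * (u g - m) ^ 2 ∂σ with hAdef
  set G : ℝ := ∫ g : SUN N, Real.exp (S g) * Gam u u g ∂σ with hGdef
  set e : ℕ → ℝ := fun k => ∫ g : SUN N, Real.exp (S g) * (genL S (v k) g - (u g - m)) ^ 2 ∂σ with hedef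
  have hA0 : 0 ≤ A := integral_nonneg fun g => mul_nonneg (Real.exp_pos _).le (sq_nonneg _)
  have hG0 : 0 ≤ G := integral_nonneg fun g => mul_nonneg (Real.exp_pos _).le (Gam_self_nonneg _ _)
  have he0 : ∀ k, 0 ≤ e k := fun k => integral_nonneg fun g => mul_nonneg (Real.exp_pos _).le (sq_nonneg _)
  change K * A ≤ G
  -- the key estimate for each `k`
  have hkey : ∀ k, A ≤ Real.sqrt (G / K) * (Real.sqrt A + Real.sqrt (e k)) + Real.sqrt A * Real.sqrt (e k) := by
    intro k
    have hvk := hv k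
    have hLc : Continuous fun g : SUN N => genL S (v k) g := continuous_restrict (contDiff_genL hS hvk)
    have huc : Continuous fun g : SUN N => u g - m := continuous_restrict hu0
    have hwc : Continuous fun g : SUN N => Real.exp (S g) := Real.continuous_exp.comp hSc
    -- Step 1: `A = ∫ w (u-m) L v_k + ∫ w (u-m) ((u-m) - L v_k)`
    have i1 : Integrable (fun g : SUN N => Real.exp (S g) * ((u g - m) * genL S (v k) g)) σ :=
      integrable_of_continuous_SUN (hwc.mul (huc.mul hLc)) σ
    have i2 : Integrable (fun g : SUN N => Real.exp (S g) * ((u g - m) * ((u g - m) - genL S (v k) g))) σ :=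
      integrable_of_continuous_SUN (hwc.mul (huc.mul (huc.sub hLc))) σ
    have hsplit : A = ∫ g : SUN N, Real.exp (S g) * ((u g - m) * genL S (v k) g) ∂σ +
        ∫ g : SUN N, Real.exp (S g) * ((u g - m) * ((u g - m) - genL S (v k) g)) ∂σ := by
      rw [← integral_add i1 i2]
      refine integral_congr_ae (ae_of_all _ fun g => ?_)
      ring
    -- Step 2: `∫ w (u-m) L v_k = -∫ w Γ(u, v_k)` (symmetry, `∫ w L v_k = 0`, and `D(u - m) = D u`)
    have hstep2 : ∫ g : SUN N, Real.exp (S g) * ((u g - m) * genL S (v k) g) ∂σ =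
        -∫ g : SUN N, Real.exp (S g) * Gam u (v k) g ∂σ := by
      have h1 := integral_mul_exp_mul_genL hN hS hu hvk
      have h2 := integral_exp_mul_genL_eq_zero hN hS hvk
      have : ∫ g : SUN N, Real.exp (S g) * ((u g - m) * genL S (v k) g) ∂σ =
          ∫ g : SUN N, u g * (Real.exp (S g) * genL S (v k) g) ∂σ -
            m * ∫ g : SUN N, Real.exp (S g) * genL S (v k) g ∂σ := by
        have i3 : Integrable (fun g : SUN N => u g * (Real.exp (S g) * genL S (v k) g)) σ :=
          integrable_of_continuous_SUN ((continuous_restrict hu).mul (hwc.mul hLc)) σ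
        have i4 : Integrable (fun g : SUN N => m * (Real.exp (S g) * genL S (v k) g)) σ :=
          (integrable_of_continuous_SUN (hwc.mul hLc) σ).const_mul m
        rw [← integral_const_mul, ← integral_sub i3 i4]
        refine integral_congr_ae (ae_of_all _ fun g => ?_)
        ring
      rw [this, h1, h2, mul_zero, sub_zero]
    -- Step 3 & 4: `|∫ w Γ(u,v_k)| ≤ √G √(∫ w Γ(v_k,v_k)) ≤ √G √((1/K) ∫ w (L v_k)²)`
    have hstep3 := abs_integral_exp_mul_Gam_le hS hu hvk σ
    have hstep4 : ∫ g : SUN N, Real.exp (S g) * Gam (v k) (v k) g ∂σ ≤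
        (1 / K) * ∫ g : SUN N, Real.exp (S g) * genL S (v k) g ^ 2 ∂σ := by
      have h := hGam hvk
      rw [one_div, ← div_eq_inv_mul, le_div_iff₀ hK, mul_comm]
      exact h
    -- Step 5: `|∫ w (u-m)((u-m) - L v_k)| ≤ √A √(e k)`
    have hstep5 : |∫ g : SUN N, Real.exp (S g) * ((u g - m) * ((u g - m) - genL S (v k) g)) ∂σ| ≤
        Real.sqrt A * Real.sqrt (e k) := by
      have h := abs_integral_exp_mul_mul_le (f := fun g : SUN N => u g - m)
        (g := fun g : SUN N => (u g - m) - genL S (v k) g) hSc huc (huc.sub hLc) σ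
      have : ∫ g : SUN N, Real.exp (S g) * ((u g - m) - genL S (v k) g) ^ 2 ∂σ = e k := by
        simp only [hedef]
        refine integral_congr_ae (ae_of_all _ fun g => ?_)
        ring
      rwa [this] at h
    -- Step 6: `∫ w (L v_k)² ≤ (√A + √(e k))²`
    have hstep6 : ∫ g : SUN N, Real.exp (S g) * genL S (v k) g ^ 2 ∂σ ≤ (Real.sqrt A + Real.sqrt (e k)) ^ 2 := by
      have hcs := abs_integral_exp_mul_mul_le (f := fun g : SUN N => u g - m)
        (g := fun g : SUN N => genL S (v k) g - (u g - m)) hSc huc (hLc.sub huc) σ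
      have hek : ∫ g : SUN N, Real.exp (S g) * (genL S (v k) g - (u g - m)) ^ 2 ∂σ = e k := rfl
      rw [hek] at hcs
      have hexp : ∫ g : SUN N, Real.exp (S g) * genL S (v k) g ^ 2 ∂σ =
          A + 2 * ∫ g : SUN N, Real.exp (S g) * ((u g - m) * (genL S (v k) g - (u g - m))) ∂σ +
            ∫ g : SUN N, Real.exp (S g) * (genL S (v k) g - (u g - m)) ^ 2 ∂σ := by
        have j1 : Integrable (fun g : SUN N => Real.exp (S g) * (u g - m) ^ 2) σ :=
          integrable_of_continuous_SUN (hwc.mul (huc.pow 2)) σ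
        have j2 : Integrable (fun g : SUN N => 2 * (Real.exp (S g) * ((u g - m) * (genL S (v k) g - (u g - m))))) σ :=
          (integrable_of_continuous_SUN (hwc.mul (huc.mul (hLc.sub huc))) σ).const_mul 2
        have j12 : Integrable (fun g : SUN N => Real.exp (S g) * (u g - m) ^ 2 +
            2 * (Real.exp (S g) * ((u g - m) * (genL S (v k) g - (u g - m))))) σ := j1.add j2
        have j3 : Integrable (fun g : SUN N => Real.exp (S g) * (genL S (v k) g - (u g - m)) ^ 2) σ :=
          integrable_of_continuous_SUN (hwc.mul ((hLc.sub huc).pow 2)) σ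
        rw [← integral_const_mul, hAdef, ← integral_add j1 j2, ← integral_add j12 j3]
        refine integral_congr_ae (ae_of_all _ fun g => ?_)
        ring
      have hek : ∫ g : SUN N, Real.exp (S g) * (genL S (v k) g - (u g - m)) ^ 2 ∂σ = e k := rfl
      rw [hexp, hek, add_sq, Real.sq_sqrt hA0, Real.sq_sqrt (he0 k)]
      have := (abs_le.1 hcs).2
      nlinarith
    -- combine
    have h34 : |∫ g : SUN N, Real.exp (S g) * Gam u (v k) g ∂σ| ≤
        Real.sqrt G * Real.sqrt ((1 / K) * (Real.sqrt A + Real.sqrt (e k)) ^ 2) := by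
      refine hstep3.trans (mul_le_mul_of_nonneg_left (Real.sqrt_le_sqrt (hstep4.trans ?_)) (Real.sqrt_nonneg _))
      exact mul_le_mul_of_nonneg_left hstep6 (by positivity)
    have hsqrt : Real.sqrt ((1 / K) * (Real.sqrt A + Real.sqrt (e k)) ^ 2) =
        Real.sqrt (1 / K) * (Real.sqrt A + Real.sqrt (e k)) := by
      rw [Real.sqrt_mul (by positivity), Real.sqrt_sq (by positivity)]
    rw [hsqrt] at h34
    have hGK : Real.sqrt G * (Real.sqrt (1 / K) * (Real.sqrt A + Real.sqrt (e k))) =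
        Real.sqrt (G / K) * (Real.sqrt A + Real.sqrt (e k)) := by
      rw [← mul_assoc, ← Real.sqrt_mul hG0, ← div_eq_mul_one_div]
    rw [hGK] at h34
    have h2' := (abs_le.1 h34).1
    have h5' := (abs_le.1 hstep5).2
    linarith [hsplit, hstep2, h2', h5']
  -- pass to the limit `e k → 0`
  have hlim : Tendsto (fun k => Real.sqrt (G / K) * (Real.sqrt A + Real.sqrt (e k)) + Real.sqrt A * Real.sqrt (e k))
      atTop (𝓝 (Real.sqrt (G / K) * (Real.sqrt A + Real.sqrt 0) + Real.sqrt A * Real.sqrt 0)) := by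
    have hse : Tendsto (fun k => Real.sqrt (e k)) atTop (𝓝 (Real.sqrt 0)) :=
      (Real.continuous_sqrt.tendsto 0).comp hconv
    exact ((tendsto_const_nhds.add hse).const_mul _).add (hse.const_mul _)
  rw [Real.sqrt_zero, add_zero, mul_zero, add_zero] at hlim
  have hAle : A ≤ Real.sqrt (G / K) * Real.sqrt A := ge_of_tendsto' hlim hkey
  -- `A ≤ √(G/K) √A ⇒ K A ≤ G`
  by_cases hA1 : Real.sqrt A = 0
  · have : A = 0 := by rwa [Real.sqrt_eq_zero hA0] at hA1
    rw [this, mul_zero]; exact hG0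
  · have hsApos : 0 < Real.sqrt A := lt_of_le_of_ne (Real.sqrt_nonneg A) (Ne.symm hA1)
    have h1 : Real.sqrt A * Real.sqrt A ≤ Real.sqrt (G / K) * Real.sqrt A := by rwa [Real.mul_self_sqrt hA0]
    have h2 : Real.sqrt A ≤ Real.sqrt (G / K) := le_of_mul_le_mul_right h1 hsApos
    have h3 : A ≤ G / K := by
      calc A = Real.sqrt A ^ 2 := (Real.sq_sqrt hA0).symm
        _ ≤ Real.sqrt (G / K) ^ 2 := pow_le_pow_left₀ (Real.sqrt_nonneg A) h2 2
        _ = G / K := Real.sq_sqrt (div_nonneg hG0 hK.le)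
    rwa [le_div_iff₀ hK, mul_comm] at h3

/-- **Poincaré inequality from THM(IV) with an abstract curvature constant** (the tree's
`SUNBakryEmery.poincare_of_thm4`, `K` abstracted as in `poincare_of_approx_K`): the class
`{e^{-S/2} p : p polynomial}` solves `L_S v = u - m` approximately in `L²(e^S σ)`, hence
`K ∫ e^S (u - m)² dσ ≤ ∫ e^S Γ(u,u) dσ`, `m` the `e^S σ`-mean. Proof verbatim from the tree. [folklore] -/
theorem poincare_of_thm4_K (hN : N ≠ 0) (c : ℝ) (B : Matrix (Fin N) (Fin N) ℂ) {K : ℝ} (hK : 0 < K)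
    (hGam : ∀ {v : Matrix (Fin N) (Fin N) ℂ → ℝ}, ContDiff ℝ ∞ v →
      K * ∫ g : SUN N, Real.exp (pot c B g) * Gam v v g ∂(haarSU N) ≤
        ∫ g : SUN N, Real.exp (pot c B g) * genL (pot c B) v g ^ 2 ∂(haarSU N))
    (hthm : ∀ w : Lp ℝ 2 (haarSU N), (∀ n, ∀ p ∈ polySpace N n,
      ∫ g : SUN N, w g * (Lap p g - schW c B g * p g) ∂(haarSU N) = 0) →
      ∃ m : ℝ, (fun g => w g) =ᵐ[haarSU N] fun g => m * Real.exp (pot c B g / 2))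
    {u : Matrix (Fin N) (Fin N) ℂ → ℝ} (hu : ContDiff ℝ ∞ u) :
    K * ∫ g : SUN N, Real.exp (pot c B g) * (u g -
          (∫ g : SUN N, Real.exp (pot c B g) * u g ∂(haarSU N)) / (∫ g : SUN N, Real.exp (pot c B g) ∂(haarSU N))) ^ 2
          ∂(haarSU N) ≤
      ∫ g : SUN N, Real.exp (pot c B g) * Gam u u g ∂(haarSU N) := by
  set S : Matrix (Fin N) (Fin N) ℂ → ℝ := pot c B with hSdef
  have hS : ContDiff ℝ ∞ S := contDiff_pot c B
  have hSc : Continuous fun g : SUN N => S g := continuous_restrict hS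
  have hwc : Continuous fun g : SUN N => Real.exp (S g) := Real.continuous_exp.comp hSc
  set Z : ℝ := ∫ g : SUN N, Real.exp (S g) ∂(haarSU N) with hZ
  have hZpos : 0 < Z := integral_exp_pos (integrable_of_continuous_SUN hwc _)
  set m : ℝ := (∫ g : SUN N, Real.exp (S g) * u g ∂(haarSU N)) / Z with hmdef
  have huc : Continuous fun g : SUN N => u g := continuous_restrict hu
  have hm0 : ∫ g : SUN N, Real.exp (S g) * (u g - m) ∂(haarSU N) = 0 := by
    have i1 : Integrable (fun g : SUN N => Real.exp (S g) * u g) (haarSU N) := integrable_of_continuous_SUN (hwc.mul huc) _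
    have i2 : Integrable (fun g : SUN N => Real.exp (S g) * m) (haarSU N) := integrable_of_continuous_SUN (hwc.mul continuous_const) _
    have : ∫ g : SUN N, Real.exp (S g) * (u g - m) ∂(haarSU N) =
        ∫ g : SUN N, Real.exp (S g) * u g ∂(haarSU N) - ∫ g : SUN N, Real.exp (S g) * m ∂(haarSU N) := by
      rw [← integral_sub i1 i2]; exact integral_congr_ae (ae_of_all _ fun g => by ring)
    rw [this, integral_mul_const, hmdef, ← hZ]
    field_simp
    ring
  -- the target vector `y = e^{S/2}(u - m)` and the range `R` of `(Δ - W)` on polynomials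
  have hyc : Continuous fun g : SUN N => Real.exp (S g / 2) * (u g - m) :=
    (Real.continuous_exp.comp (hSc.div_const 2)).mul (huc.sub continuous_const)
  set y : Lp ℝ 2 (haarSU N) := toL2 (resCM (fun Q => Real.exp (S Q / 2) * (u Q - m)) hyc) with hydef
  set R : Submodule ℝ (Lp ℝ 2 (haarSU N)) := ⨆ n, LinearMap.range (AnPoly (N := N) c B n) with hRdef
  -- `y ⟂ Rᗮ`
  have hyRR : y ∈ Rᗮᗮ := by
    rw [Submodule.mem_orthogonal]
    intro z hz
    -- `z` is orthogonal to all `(Δ - W)p`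
    have hz' : ∀ n, ∀ p ∈ polySpace N n,
        ∫ g : SUN N, z g * (Lap p g - schW c B g * p g) ∂(haarSU N) = 0 := by
      intro n p hp
      have hmem : AnPoly c B n ⟨p, hp⟩ ∈ R := (le_iSup (fun n => LinearMap.range (AnPoly (N := N) c B n)) n) ⟨_, rfl⟩
      have h0 : ⟪AnPoly c B n ⟨p, hp⟩, z⟫_ℝ = 0 := (Submodule.mem_orthogonal R z).1 hz _ hmem
      rw [AnPoly_apply, inner_toL2_left] at h0
      rw [← h0]
      refine integral_congr_ae (ae_of_all _ fun g => ?_)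
      simp only [gsCM_apply]
      ring
    obtain ⟨mz, hmz⟩ := hthm z hz'
    rw [real_inner_comm, hydef, inner_toL2_left]
    have : ∫ g : SUN N, (resCM (fun Q => Real.exp (S Q / 2) * (u Q - m)) hyc) g * z g ∂(haarSU N) =
        ∫ g : SUN N, mz * (Real.exp (S g) * (u g - m)) ∂(haarSU N) := by
      refine integral_congr_ae ?_
      filter_upwards [hmz] with g hg
      rw [hg]
      simp only [resCM, ContinuousMap.coe_mk]
      rw [← exp_half_mul_exp_half (S g)]
      simp only [hSdef]
      ring
    rw [this, integral_const_mul, hm0, mul_zero]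
  -- hence `y` lies in the closure of `R`
  have hyclos : y ∈ R.topologicalClosure := by
    rw [← Submodule.orthogonal_orthogonal_eq_closure]; exact hyRR
  have hyclos' : y ∈ closure (R : Set (Lp ℝ 2 (haarSU N))) := by
    rw [← Submodule.topologicalClosure_coe]; exact hyclos
  obtain ⟨r, hrR, hrlim⟩ := mem_closure_iff_seq_limit.1 hyclos'
  -- extract polynomials
  have hdir : Directed (· ≤ ·) fun n => LinearMap.range (AnPoly (N := N) c B n) :=
    (monotone_range_AnPoly c B).directed_le
  have hex : ∀ k, ∃ (n : ℕ) (p : polySpace N n), AnPoly c B n p = r k := fun k => by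
    obtain ⟨n, hn⟩ := (Submodule.mem_iSup_of_directed _ hdir).1 (hrR k)
    obtain ⟨p, hp⟩ := LinearMap.mem_range.1 hn
    exact ⟨n, p, hp⟩
  choose nk pk hpk using hex
  -- the approximate solutions `v_k = e^{-S/2} p_k`
  set v : ℕ → Matrix (Fin N) (Fin N) ℂ → ℝ := fun k Q => Real.exp (-S Q / 2) * (pk k).1 Q with hvdef
  have hv : ∀ k, ContDiff ℝ ∞ (v k) := fun k => contDiff_groundState hS (contDiff_of_mem_polySpace (pk k).2)
  have hconv : Tendsto (fun k => ∫ g : SUN N, Real.exp (S g) * (genL S (v k) g - (u g - m)) ^ 2 ∂(haarSU N))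
      atTop (𝓝 0) := by
    have h1 : Tendsto (fun k => ‖r k - y‖ ^ 2) atTop (𝓝 0) := by
      have := tendsto_iff_norm_sub_tendsto_zero.1 hrlim
      simpa using this.pow 2
    refine h1.congr fun k => ?_
    rw [← hpk k, AnPoly_apply, hydef, norm_toL2_sub_toL2_sq]
    refine integral_congr_ae (ae_of_all _ fun g => ?_)
    simp only [gsCM_apply, resCM, ContinuousMap.coe_mk, hvdef]
    rw [genL_groundState hS (contDiff_of_mem_polySpace (pk k).2)]
    have e1 := exp_half_mul_exp_half (S g)
    have e2 := exp_half_mul_exp_neg_half (S g)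
    have hW : schW c B g = (1 / 4) * Gam S S g + (1 / 2) * Lap S g := rfl
    rw [hW]
    linear_combination ((Real.exp (-S g / 2) * (Lap (pk k).1 g - ((1 / 4) * Gam S S g + (1 / 2) * Lap S g) *
      (pk k).1 g) - (u g - m)) ^ 2) * e1 +
      (-((Lap (pk k).1 g - ((1 / 4) * Gam S S g + (1 / 2) * Lap S g) * (pk k).1 g) *
        ((Lap (pk k).1 g - ((1 / 4) * Gam S S g + (1 / 2) * Lap S g) * (pk k).1 g) *
          (1 + Real.exp (S g / 2) * Real.exp (-S g / 2)) - 2 * Real.exp (S g / 2) * (u g - m)))) * e2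
  have key := poincare_of_approx_K hN c B hK hGam hu m v hv hconv
  exact key

/-- **The Poincaré inequality for the one-link Gibbs measure with an abstract curvature constant**
(the tree's `SUNBakryEmery.poincare_pot` with `K` abstracted): if `K > 0` satisfies the integrated
Bochner inequality `K ∫ e^S Γ(v,v) ≤ ∫ e^S (L_S v)²` for all smooth `v` (`S = c Re tr(· B)`), then
`K ∫ e^S (u - m)² dσ ≤ ∫ e^S Γ(u,u) dσ` for smooth `u`, `m` its `e^S σ`-mean. [folklore] -/
theorem poincare_pot_K (hN : N ≠ 0) (c : ℝ) (B : Matrix (Fin N) (Fin N) ℂ) {K : ℝ} (hK : 0 < K)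
    (hGam : ∀ {v : Matrix (Fin N) (Fin N) ℂ → ℝ}, ContDiff ℝ ∞ v →
      K * ∫ g : SUN N, Real.exp (pot c B g) * Gam v v g ∂(haarSU N) ≤
        ∫ g : SUN N, Real.exp (pot c B g) * genL (pot c B) v g ^ 2 ∂(haarSU N))
    {u : Matrix (Fin N) (Fin N) ℂ → ℝ} (hu : ContDiff ℝ ∞ u) :
    K * ∫ g : SUN N, Real.exp (pot c B g) * (u g -
          (∫ g : SUN N, Real.exp (pot c B g) * u g ∂(haarSU N)) / (∫ g : SUN N, Real.exp (pot c B g) ∂(haarSU N))) ^ 2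
          ∂(haarSU N) ≤
      ∫ g : SUN N, Real.exp (pot c B g) * Gam u u g ∂(haarSU N) :=
  poincare_of_thm4_K hN c B hK hGam (fun w hw => ae_eq_groundState_of_orthogonal hN c B w hw) hu

end Summit.QuantumFields.BalabanUV.InfraRed.StrongCouplingDimensionalPoincare

end
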